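import Literature.NumberTheory.EllipticCurves.IwasawaAlgebra
import Mathlib.RingTheory.Ideal.AssociatedPrime.Finiteness
import HarnessLib

/-!
# Howard's Eisenstein primes `q_m = T^m + p` are regular on a finitely generated `Λ`-module without
# `p`-torsion for all `m ≫ 0`; hence a `p`-saturated submodule `S ≤ H` satisfies `S ∩ q_m H = q_m S` for `m ≫ 0`
# (the compact control map `S/q_mS → H/q_mH` is INJECTIVE, not merely of finite kernel)

Support algebra for crux stmt-BirchSwinnertonDyer-24737 `UniversalToricDescent.TwinAlgMuZeroAtThree`, line `beta-road` v10
(K2 stub `stub_howardOutputsOfFamily`, conjunct (H-i′) «`𝔖/q_m𝔖` cyclic for ONE `m ≥ 1`», which consumes an INJECTIVE compact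
control map `𝔖/q_m𝔖 ↪ H¹_F(K, T ⊗ S_m)`; LEAD bsd-wall-utd-p1 g24, memo `K2-JOIN-MAP-utdp1g24.md` §3(b)). Howard, Prop. 2.2.8,
gives the control maps finite kernels outside a finite exceptional set `Σ_Λ` of height-one primes; at the Eisenstein primes
`𝔮 = (q_m)` the kernel of the compact half is `(H/𝔖)[q_m]` for `H = H¹(K_Σ/K, 𝐓)` (`H/q_mH ↪ H¹(K, T_𝔮)`), and this file shows
it VANISHES for all large `m` as soon as `H/𝔖` has no `p`-torsion (the `Λ`-adic Selmer module is `p`-saturated in `H`: the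
local quotients `H¹(K_w, T)/(E(K_w) ⊗ ℤ_p) ↪ T_p H¹(K_w, E)` are torsion-free):

* §1 `isUnit_X_pow_sub_one`, `subsingleton_setOf_X_pow_add_C_mem` — a prime ideal of `Λ` not containing `p` contains
  `q_m` for AT MOST ONE `m` (`q_{m'} − q_m = T^m (T^{m'−m} − 1)` with `T^{m'−m} − 1` a unit).
* §2 **`exists_forall_X_pow_add_C_smul_eq_zero_imp`** — `M` finitely generated over `Λ` (Noetherian), `p` regular on `M`
  ⟹ `∃ m₀ ∀ m ≥ m₀`, `q_m` is regular on `M`: the zero-divisors on `M` are the union of the finitely many associated primes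
  (Mathlib `biUnion_associatedPrimes_eq_zero_divisors`, `associatedPrimes.finite`), none of which contains `p`.
  `…_of_nsmul` — the same with the hypothesis as «no `p`-torsion in the abelian group `M`».
* §3 **`exists_forall_mem_smul_top_of_coe_mem`** — `S ≤ H` a `p`-SATURATED submodule (`p•h ∈ S ⟹ h ∈ S`), `H/S` finitely
  generated ⟹ `∃ m₀ ∀ m ≥ m₀`, `S ∩ q_m•H = q_m•S`; **`exists_forall_ker_le_smul_top`** — equivalently the control map
  `S → H/q_mH` has kernel `≤ q_m•S`, the hypothesis `hker` of
  `UniversalToricDescentFreeOfCyclicSpecialization.exists_forall_sub_smul_mem_of_ker_le` (p749666).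

THEOREMS ONLY; no `sorry`, no definition, no named fact; imports no `Theses` module. Nothing about Selmer groups is asserted;
BSD is not proved by any of this. References: B. Howard, Compositio Math. 140 (2004), Lemma 2.2.7, Prop. 2.2.8 and proof of
Thm. 2.2.10 (the exceptional set `Σ_Λ`; `𝔮 = T^m + p`); B. Mazur, K. Rubin, Mem. AMS 799 (2004), Prop. 5.3.14; H. Matsumura,
*Commutative Ring Theory*, Thm. 6.1 and 6.5 (associated primes and zero-divisors).
-/

set_option linter.dupNamespace false
set_option autoImplicit false

noncomputable section

open scoped Classical

namespace Summit.BirchSwinnertonDyer.BirchSwinnertonDyer.Theorems.UniversalToricDescentEisensteinRegular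

open Literature.NumberTheory.EllipticCurves

variable {p : ℕ} [hp : Fact p.Prime]

/-! ## §1 One prime ideal contains at most one `q_m` -/

/-- `T^k − 1` is a unit of `Λ = ℤ_p⟦T⟧` for `k ≥ 1` (constant coefficient `−1`). [cite: Washington1997, §7.1] -/
theorem isUnit_X_pow_sub_one {k : ℕ} (hk : 1 ≤ k) :
    IsUnit ((PowerSeries.X : IwasawaAlgebra p) ^ k - 1) := by
  rw [PowerSeries.isUnit_iff_constantCoeff, map_sub, map_pow, PowerSeries.constantCoeff_X,
    zero_pow (by omega), map_one, zero_sub]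
  exact isUnit_one.neg

/-- **A prime ideal of `Λ` not containing `p` contains `q_m = T^m + p` for at most one `m`**: from `q_m, q_{m'} ∈ P`,
`m < m'`, get `T^m (T^{m'−m} − 1) ∈ P`, so `T^m ∈ P` and `p = q_m − T^m ∈ P`.
[cite: Howard2004HeegnerKolyvagin, proof of Thm. 2.2.10 (the primes 𝔮 = T^m + p avoid the finite set Σ_Λ for m ≫ 0)] -/
theorem subsingleton_setOf_X_pow_add_C_mem {P : Ideal (IwasawaAlgebra p)} (hP : P.IsPrime)
    (hCp : (PowerSeries.C (p : ℤ_[p]) : IwasawaAlgebra p) ∉ P) :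
    {m : ℕ | (PowerSeries.X ^ m + PowerSeries.C (p : ℤ_[p]) : IwasawaAlgebra p) ∈ P}.Subsingleton := by
  have key : ∀ m m' : ℕ, m < m' →
      (PowerSeries.X ^ m + PowerSeries.C (p : ℤ_[p]) : IwasawaAlgebra p) ∈ P →
      (PowerSeries.X ^ m' + PowerSeries.C (p : ℤ_[p]) : IwasawaAlgebra p) ∈ P → False := by
    intro m m' hlt hm hm'
    have hdiff : (PowerSeries.X : IwasawaAlgebra p) ^ m * (PowerSeries.X ^ (m' - m) - 1) ∈ P := by
      have heq : (PowerSeries.X : IwasawaAlgebra p) ^ m * (PowerSeries.X ^ (m' - m) - 1) =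
          (PowerSeries.X ^ m' + PowerSeries.C (p : ℤ_[p])) -
            (PowerSeries.X ^ m + PowerSeries.C (p : ℤ_[p])) := by
        rw [mul_sub, ← pow_add, Nat.add_sub_cancel' hlt.le]
        ring
      rw [heq]
      exact P.sub_mem hm' hm
    have hXm : (PowerSeries.X : IwasawaAlgebra p) ^ m ∈ P := by
      refine (hP.mem_or_mem hdiff).resolve_right fun hu => hP.ne_top ?_
      exact P.eq_top_of_isUnit_mem hu (isUnit_X_pow_sub_one (by omega))
    apply hCp
    have heq : (PowerSeries.C (p : ℤ_[p]) : IwasawaAlgebra p) =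
        (PowerSeries.X ^ m + PowerSeries.C (p : ℤ_[p])) - PowerSeries.X ^ m := by ring
    rw [heq]
    exact P.sub_mem hm hXm
  intro m hm m' hm'
  rcases lt_trichotomy m m' with h | h | h
  · exact (key m m' h hm hm').elim
  · exact h
  · exact (key m' m h hm' hm).elim

/-! ## §2 `q_m` is regular on a finitely generated module without `p`-torsion, for `m ≫ 0` -/

section Module

variable {M : Type*} [AddCommGroup M] [Module (IwasawaAlgebra p) M]

/-- No associated prime of a module on which `p` is regular contains `p`.
[cite: Howard2004HeegnerKolyvagin, proof of Thm. 2.2.10 (Σ_Λ)] -/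
theorem C_p_notMem_of_mem_associatedPrimes
    (hreg : ∀ x : M, (PowerSeries.C (p : ℤ_[p]) : IwasawaAlgebra p) • x = 0 → x = 0)
    {P : Ideal (IwasawaAlgebra p)} (hP : P ∈ associatedPrimes (IwasawaAlgebra p) M) :
    (PowerSeries.C (p : ℤ_[p]) : IwasawaAlgebra p) ∉ P := by
  intro hmem
  rw [AssociatedPrimes.mem_iff, isAssociatedPrime_iff] at hP
  obtain ⟨hprime, x, rfl⟩ := hP
  rw [Submodule.mem_colon_singleton, Submodule.mem_bot] at hmem
  have hx0 : x = 0 := hreg x hmem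
  apply hprime.ne_top
  rw [eq_top_iff]
  intro r _
  rw [Submodule.mem_colon_singleton, hx0, smul_zero]
  exact Submodule.zero_mem _

/-- **`q_m = T^m + p` is `M`-regular for all large `m`** when `M` is finitely generated over `Λ` and `p` is `M`-regular:
the set of zero-divisors on `M` is the union of the finitely many associated primes of `M`, and each of them (not
containing `p`) contains at most one `q_m`. [cite: Howard2004HeegnerKolyvagin, Prop. 2.2.8 and proof of Thm. 2.2.10 (Σ_Λ; 𝔮 = T^m + p)]
[cite: MazurRubin2004, Prop. 5.3.14] -/
theorem exists_forall_X_pow_add_C_smul_eq_zero_imp [Module.Finite (IwasawaAlgebra p) M]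
    (hreg : ∀ x : M, (PowerSeries.C (p : ℤ_[p]) : IwasawaAlgebra p) • x = 0 → x = 0) :
    ∃ m₀ : ℕ, ∀ m : ℕ, m₀ ≤ m → ∀ x : M,
      (PowerSeries.X ^ m + PowerSeries.C (p : ℤ_[p]) : IwasawaAlgebra p) • x = 0 → x = 0 := by
  set S : Set ℕ := {m | ∃ P ∈ associatedPrimes (IwasawaAlgebra p) M,
    (PowerSeries.X ^ m + PowerSeries.C (p : ℤ_[p]) : IwasawaAlgebra p) ∈ P} with hS
  have hSfin : S.Finite := by
    have hSeq : S = ⋃ P ∈ associatedPrimes (IwasawaAlgebra p) M,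
        {m | (PowerSeries.X ^ m + PowerSeries.C (p : ℤ_[p]) : IwasawaAlgebra p) ∈ P} := by
      ext m
      simp only [hS, Set.mem_setOf_eq, Set.mem_iUnion, exists_prop]
    rw [hSeq]
    exact (associatedPrimes.finite (IwasawaAlgebra p) M).biUnion fun P hP =>
      (subsingleton_setOf_X_pow_add_C_mem (IsAssociatedPrime.isPrime hP)
        (C_p_notMem_of_mem_associatedPrimes hreg hP)).finite
  obtain ⟨B, hB⟩ := hSfin.bddAbove
  refine ⟨B + 1, fun m hm x hx => ?_⟩
  by_contra hx0
  have hzd : (PowerSeries.X ^ m + PowerSeries.C (p : ℤ_[p]) : IwasawaAlgebra p) ∈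
      {r : IwasawaAlgebra p | ∃ x : M, x ≠ 0 ∧ r • x = 0} := ⟨x, hx0, hx⟩
  rw [← biUnion_associatedPrimes_eq_zero_divisors] at hzd
  simp only [Set.mem_iUnion, SetLike.mem_coe, exists_prop] at hzd
  obtain ⟨P, hP, hmemP⟩ := hzd
  have hmB : m ≤ B := hB ⟨P, hP, hmemP⟩
  omega

/-- The same with the hypothesis «`M` has no `p`-torsion as an abelian group».
[cite: Howard2004HeegnerKolyvagin, Prop. 2.2.8 and proof of Thm. 2.2.10] -/
theorem exists_forall_X_pow_add_C_smul_eq_zero_imp_of_nsmul [Module.Finite (IwasawaAlgebra p) M]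
    (hreg : ∀ x : M, p • x = 0 → x = 0) :
    ∃ m₀ : ℕ, ∀ m : ℕ, m₀ ≤ m → ∀ x : M,
      (PowerSeries.X ^ m + PowerSeries.C (p : ℤ_[p]) : IwasawaAlgebra p) • x = 0 → x = 0 := by
  refine exists_forall_X_pow_add_C_smul_eq_zero_imp fun x hx => hreg x ?_
  rwa [map_natCast (PowerSeries.C (R := ℤ_[p])) p, Nat.cast_smul_eq_nsmul] at hx

end Module

/-! ## §3 A `p`-saturated submodule: `S ∩ q_m H = q_m S` for `m ≫ 0` (injective compact control) -/

section Saturated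

variable {H : Type*} [AddCommGroup H] [Module (IwasawaAlgebra p) H] (S : Submodule (IwasawaAlgebra p) H)

/-- **`S ∩ q_m•H = q_m•S` for all large `m`** when `S ≤ H` is `p`-saturated (`p•h ∈ S ⟹ h ∈ S`) and `H/S` is finitely
generated: `q_m` is regular on `H/S` for `m ≫ 0` (§2). In Howard's setting (`S = 𝔖 ≤ H = H¹(K_Σ/K, 𝐓)`) this is the
vanishing of the kernel `(H/𝔖)[𝔮]` of the compact control map at `𝔮 = (T^m + p)`, `m ≫ 0`.
[cite: Howard2004HeegnerKolyvagin, Prop. 2.2.8 and proof of Thm. 2.2.10 (Σ_Λ; 𝔮 = T^m + p)] -/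
theorem exists_forall_mem_smul_top_of_coe_mem [Module.Finite (IwasawaAlgebra p) (H ⧸ S)]
    (hsat : ∀ h : H, (PowerSeries.C (p : ℤ_[p]) : IwasawaAlgebra p) • h ∈ S → h ∈ S) :
    ∃ m₀ : ℕ, ∀ m : ℕ, m₀ ≤ m → ∀ s : S,
      (s : H) ∈ (Ideal.span {(PowerSeries.X ^ m + PowerSeries.C (p : ℤ_[p]) : IwasawaAlgebra p)} :
        Ideal (IwasawaAlgebra p)) • (⊤ : Submodule (IwasawaAlgebra p) H) →
      s ∈ (Ideal.span {(PowerSeries.X ^ m + PowerSeries.C (p : ℤ_[p]) : IwasawaAlgebra p)} :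
        Ideal (IwasawaAlgebra p)) • (⊤ : Submodule (IwasawaAlgebra p) S) := by
  -- `p` is regular on `H/S` by saturation
  have hreg : ∀ x : H ⧸ S, (PowerSeries.C (p : ℤ_[p]) : IwasawaAlgebra p) • x = 0 → x = 0 := by
    intro x hx
    induction x using Submodule.Quotient.induction_on with
    | H h =>
      rw [← Submodule.Quotient.mk_smul, Submodule.Quotient.mk_eq_zero] at hx
      exact (Submodule.Quotient.mk_eq_zero S).mpr (hsat h hx)
  obtain ⟨m₀, hm₀⟩ := exists_forall_X_pow_add_C_smul_eq_zero_imp hreg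
  refine ⟨m₀, fun m hm s hs => ?_⟩
  rw [Submodule.ideal_span_singleton_smul, Submodule.mem_smul_pointwise_iff_exists] at hs ⊢
  obtain ⟨h, -, hh⟩ := hs
  -- `q_m • [h] = [s] = 0` in `H/S`, so `h ∈ S`
  have hhS : h ∈ S := by
    have h0 : (PowerSeries.X ^ m + PowerSeries.C (p : ℤ_[p]) : IwasawaAlgebra p) •
        (Submodule.Quotient.mk h : H ⧸ S) = 0 := by
      rw [← Submodule.Quotient.mk_smul, hh, Submodule.Quotient.mk_eq_zero]
      exact s.2
    exact (Submodule.Quotient.mk_eq_zero S).mp (hm₀ m hm _ h0)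
  refine ⟨⟨h, hhS⟩, Submodule.mem_top, ?_⟩
  apply Subtype.ext
  rw [Submodule.coe_smul]
  exact hh

/-- **The compact control map `S → H/q_mH` has kernel `≤ q_m•S` for all large `m`** (`S ≤ H` `p`-saturated, `H/S` finitely
generated) — the hypothesis `hker` of `UniversalToricDescentFreeOfCyclicSpecialization.exists_forall_sub_smul_mem_of_ker_le`
(cell bsd-wall, p749666) for the map `S → H/q_mH → H¹_F(K, T ⊗ S_m)` once the second arrow is injective on the image.
[cite: Howard2004HeegnerKolyvagin, Prop. 2.2.8 and proof of Thm. 2.2.10 (𝔮 = T^m + p)] -/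
theorem exists_forall_ker_le_smul_top [Module.Finite (IwasawaAlgebra p) (H ⧸ S)]
    (hsat : ∀ h : H, (PowerSeries.C (p : ℤ_[p]) : IwasawaAlgebra p) • h ∈ S → h ∈ S) :
    ∃ m₀ : ℕ, ∀ m : ℕ, m₀ ≤ m →
      LinearMap.ker ((Submodule.mkQ ((Ideal.span {(PowerSeries.X ^ m + PowerSeries.C (p : ℤ_[p]) : IwasawaAlgebra p)} :
          Ideal (IwasawaAlgebra p)) • (⊤ : Submodule (IwasawaAlgebra p) H))).comp S.subtype) ≤
        (Ideal.span {(PowerSeries.X ^ m + PowerSeries.C (p : ℤ_[p]) : IwasawaAlgebra p)} :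
          Ideal (IwasawaAlgebra p)) • (⊤ : Submodule (IwasawaAlgebra p) S) := by
  obtain ⟨m₀, hm₀⟩ := exists_forall_mem_smul_top_of_coe_mem S hsat
  refine ⟨m₀, fun m hm s hs => hm₀ m hm s ?_⟩
  rw [LinearMap.mem_ker, LinearMap.comp_apply, Submodule.subtype_apply, Submodule.mkQ_apply,
    Submodule.Quotient.mk_eq_zero] at hs
  exact hs

end Saturated

end Summit.BirchSwinnertonDyer.BirchSwinnertonDyer.Theorems.UniversalToricDescentEisensteinRegular

end
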